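import Mathlib
import Summits.QuantumFields.BalabanUV.Beta.EriceRemainderEnclosureHistoryAutonomyComparisonAgeCompositionStaticChainAdjacentStepLattice
import Summits.QuantumFields.BalabanUV.Beta.EriceRemainderEnclosureHistoryAutonomyComparisonAgeCompositionStaticChainAdjacentPairTemplate
import Summits.QuantumFields.BalabanUV.Beta.EriceRemainderEnclosureHistoryAutonomyComparisonAgeCompositionStaticChainAdjacentPairsA
import Summits.QuantumFields.BalabanUV.Beta.EriceRemainderEnclosureHistoryAutonomyComparisonAgeCompositionStaticChainAdjacentPairsB
import Summits.QuantumFields.BalabanUV.Beta.EriceRemainderEnclosureHistoryAutonomyComparisonAgeCompositionStaticChainAdjacentPairsC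

/-!
# EriceRemainderEnclosureHistoryAutonomyComparisonAgeCompositionStaticChainAdjacentAll — (E79g) THE OBSERVER STEP ABOVE EVERY ADJACENT PAIR `(z+1, z)`, `z ≥ 1`:
# the fifteen packages (E79d–f) through the template (E79c) for `z ≤ 15`, and (E78i) for `z ≥ 16` — the binding family of the observer induction is CLOSED for
# every level-coupled configuration and every admissible load

Cell `pub-balaban`, β-function sub-cell, BINDER row D4 «RemainderConst leaves for Bałaban's split» (`HOME/BINDER-OWNERS.md`; owner lineage `b2b-balaban-beta-an4`;
this file by co-owner #2 lineage `b2b-balaban-beta-d4-p2`, generation 70), β-FLOW TEAM duty (1), FREEZE (0) honoured (def-free; imports (E78i) `…AdjacentStepLattice`,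
(E79c) `…AdjacentPairTemplate`, (E79d–f) `…AdjacentPairsA∕B∕C`; nothing restated).

HONEST FRAMING (page 1, verbatim and binding).  *"Discharging BetaPertH makes Bałaban's UV stability UNCONDITIONAL — a real constructive-QFT result; it is
NOT the continuum limit and NOT the Clay problem."*  THIS FILE DISCHARGES NOTHING OF THE KIND.  Case analysis over fifteen integers plus two tree theorems —
hypotheses of a census, not facts; the age profile of Bałaban's (1.22) limit functional is NOT PRINTED ([I] p. 298; GAPS G-t4-U2-1∕-2) and NOT asserted.  Row
D4 class UNCHANGED (critical-path width 0; instance 0∕1; D4 DISCHARGE NO DATE).  HONEST DEPENDENCY: continuum YM on T⁴ ⇐ BetaPertH ∧ nine spine estimates (0/9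
proved); BetaPertH ⇐ (D1) ∧ (D4) ∧ CAP+tail; G-an2-4 gates asym, D1 and NE2/3/4.

THE POINT (census sense (α); route (N′); README `HOME/b2b-balaban-beta-d4-p2/g70/e79/README.md`).  §1 `adjacent_step_lattice_le15`: the statement of (E78i)
`adjacent_step_lattice` with `16 ≤ z` replaced by `1 ≤ z ≤ 15`, by `interval_cases z` and (E79c) `adjacent_pair_step_lattice` with the package `facts_z` of
(E79d–f).  §2 **`adjacent_step_lattice_all`**: the same statement for EVERY `z ≥ 1` (§1 or (E78i)).  SO: for every adjacent pair of scales — the binding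
infinite family of the induction, where the adversarial supremum `0.914` of the step ratio lives (README (E78) §4) — the observer bound `N_z ≤ (1+2κΨ_zz)(1−Ω_z)`
PROPAGATES through the addition of the age `z+1`, for every level-coupled configuration of older ages and every admissible load, with the ONLY remaining
hypotheses the defect envelope `θ ≤ 0.7856` ((E78f) `thetabar_le_envelope`) and the cap ((E78b) `pivot_pos`).  WHAT REMAINS for route (N′) at first order: the
non-adjacent pairs (`q`-bands; by (E79a)∕(E79b) each band is one package — margins ≥ 11 %, and for the far pairs the Grüss factor `1∕4` in the covariance bound;
README §4), the assembly of the induction as one theorem, then identification with the flow and MONO∕MONO′.  NOT CLAIMED: those; the static closure; printed.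

WHAT IS PROVED ([folklore]; 0 `def`, 0 sorry).  §1 `adjacent_step_lattice_le15`.  §2 **`adjacent_step_lattice_all`**.
-/
noncomputable section
open Finset

namespace Summit.QuantumFields.BalabanUV.Beta.EriceRemainderEnclosureHistoryAutonomyComparisonAgeCompositionStaticChainAdjacentAll

open Summit.QuantumFields.BalabanUV.Beta.EriceRemainderEnclosureHistoryAutonomyComparisonAgeCompositionStaticChainAdjacentStepLattice
open Summit.QuantumFields.BalabanUV.Beta.EriceRemainderEnclosureHistoryAutonomyComparisonAgeCompositionStaticChainAdjacentPairTemplate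
open Summit.QuantumFields.BalabanUV.Beta.EriceRemainderEnclosureHistoryAutonomyComparisonAgeCompositionStaticChainAdjacentPairsA
open Summit.QuantumFields.BalabanUV.Beta.EriceRemainderEnclosureHistoryAutonomyComparisonAgeCompositionStaticChainAdjacentPairsB
open Summit.QuantumFields.BalabanUV.Beta.EriceRemainderEnclosureHistoryAutonomyComparisonAgeCompositionStaticChainAdjacentPairsC

/-! ## §1 The fifteen small adjacent pairs -/

/-- **THE OBSERVER STEP ABOVE `(z+1, z)` FOR `1 ≤ z ≤ 15`** — the statement of (E78i) `adjacent_step_lattice` for the small pairs: every level-coupled configuration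
of older ages `k_l ≥ z+2`, every admissible load; from (E79c) `adjacent_pair_step_lattice` and the packages `facts_1, …, facts_15` of (E79d–f). [folklore] -/
theorem adjacent_step_lattice_le15 {n z : ℕ} {k : ℕ → ℕ} {x a cy cz Sy Sz Ry Rz : ℕ → ℝ} {θ xy Ψyy Ψyz Ψzy Ψzz Ωz σ φ s : ℝ}
    (hn : 0 < n) (hz1 : 1 ≤ z) (hz15 : z ≤ 15) (hk : ∀ l, l < n → z + 2 ≤ k l) (hx : ∀ l, l < n → 0 ≤ x l)
    (hSy : ∀ l, l < n → Sy l = ∑ m ∈ range (z + 1), Real.sqrt ((k l : ℝ) / ((k l : ℝ) + m + 1)))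
    (hSz : ∀ l, l < n → Sz l = ∑ m ∈ range z, Real.sqrt ((k l : ℝ) / ((k l : ℝ) + m + 1)))
    (hRy : ∀ l, l < n → Ry l = ∑ m ∈ range (k l), Real.sqrt (((z:ℝ) + 1) / (((z:ℝ) + 1) + m + 1)))
    (hRz : ∀ l, l < n → Rz l = ∑ m ∈ range (k l), Real.sqrt ((z : ℝ) / ((z : ℝ) + m + 1)))
    (ha0 : ∀ i, i < n → 0 < a i)
    (ha : ∀ i, i < n → a i = 1 + ∑ l ∈ range n,
      (2 * x l * (∑ m ∈ range (k i), Real.sqrt ((k l : ℝ) / ((k l : ℝ) + m + 1))) / k l) * a l)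
    (hcy : ∀ i, i < n → cy i = Ry i / ((z:ℝ) + 1) + ∑ l ∈ range n,
      (2 * x l * (∑ m ∈ range (k i), Real.sqrt ((k l : ℝ) / ((k l : ℝ) + m + 1))) / k l) * cy l)
    (hcz : ∀ i, i < n → cz i = Rz i / (z:ℝ) + ∑ l ∈ range n,
      (2 * x l * (∑ m ∈ range (k i), Real.sqrt ((k l : ℝ) / ((k l : ℝ) + m + 1))) / k l) * cz l)
    (hΨyy : Ψyy = ∑ l ∈ range n, (2 * x l * Sy l / k l) * cy l) (hΨyz : Ψyz = ∑ l ∈ range n, (2 * x l * Sz l / k l) * cy l)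
    (hΨzy : Ψzy = ∑ l ∈ range n, (2 * x l * Sy l / k l) * cz l) (hΨzz : Ψzz = ∑ l ∈ range n, (2 * x l * Sz l / k l) * cz l)
    (hΩz : Ωz = ∑ l ∈ range n, x l * (z:ℝ) / k l)
    (hσ : σ = (∑ m ∈ range z, Real.sqrt (((z:ℝ) + 1) / (((z:ℝ) + 1) + m + 1))) / ((z:ℝ) + 1))
    (hφ : φ = (∑ m ∈ range (z + 1), Real.sqrt ((z : ℝ) / ((z : ℝ) + m + 1))) / (z:ℝ))
    (hs : s = (∑ m ∈ range (z + 1), Real.sqrt (((z:ℝ) + 1) / (((z:ℝ) + 1) + m + 1))) / ((z:ℝ) + 1))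
    (hθ : θ ≤ 491/625) (hxy : 0 ≤ xy) (hcap : 2 * xy * (s + Ψyy) < 1) :
    (1 + 2 * (31/40:ℝ) * Ψzz) * (1 - Ωz) - (1 - θ) * (xy * (1 + 2 * (31/40:ℝ) * Ψyy))
      ≤ (1 - xy * (1 + 2 * (31/40:ℝ) * Ψyy)) *
        ((1 + 2 * (31/40:ℝ) * Ψzz + 4 * (31/40:ℝ) * xy * ((σ + Ψyz) * (φ + Ψzy)) / (1 - 2 * (s + Ψyy) * xy)) * ((1 - Ωz) - xy / (((z:ℝ) + 1) / (z:ℝ)))) := by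
  interval_cases z
  · exact adjacent_pair_step_lattice (by norm_num) facts_1 hn hk hx hSy hSz hRy hRz ha0 ha hcy hcz hΨyy hΨyz hΨzy hΨzz hΩz hσ hφ hs hθ hxy hcap
  · exact adjacent_pair_step_lattice (by norm_num) facts_2 hn hk hx hSy hSz hRy hRz ha0 ha hcy hcz hΨyy hΨyz hΨzy hΨzz hΩz hσ hφ hs hθ hxy hcap
  · exact adjacent_pair_step_lattice (by norm_num) facts_3 hn hk hx hSy hSz hRy hRz ha0 ha hcy hcz hΨyy hΨyz hΨzy hΨzz hΩz hσ hφ hs hθ hxy hcap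
  · exact adjacent_pair_step_lattice (by norm_num) facts_4 hn hk hx hSy hSz hRy hRz ha0 ha hcy hcz hΨyy hΨyz hΨzy hΨzz hΩz hσ hφ hs hθ hxy hcap
  · exact adjacent_pair_step_lattice (by norm_num) facts_5 hn hk hx hSy hSz hRy hRz ha0 ha hcy hcz hΨyy hΨyz hΨzy hΨzz hΩz hσ hφ hs hθ hxy hcap
  · exact adjacent_pair_step_lattice (by norm_num) facts_6 hn hk hx hSy hSz hRy hRz ha0 ha hcy hcz hΨyy hΨyz hΨzy hΨzz hΩz hσ hφ hs hθ hxy hcap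
  · exact adjacent_pair_step_lattice (by norm_num) facts_7 hn hk hx hSy hSz hRy hRz ha0 ha hcy hcz hΨyy hΨyz hΨzy hΨzz hΩz hσ hφ hs hθ hxy hcap
  · exact adjacent_pair_step_lattice (by norm_num) facts_8 hn hk hx hSy hSz hRy hRz ha0 ha hcy hcz hΨyy hΨyz hΨzy hΨzz hΩz hσ hφ hs hθ hxy hcap
  · exact adjacent_pair_step_lattice (by norm_num) facts_9 hn hk hx hSy hSz hRy hRz ha0 ha hcy hcz hΨyy hΨyz hΨzy hΨzz hΩz hσ hφ hs hθ hxy hcap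
  · exact adjacent_pair_step_lattice (by norm_num) facts_10 hn hk hx hSy hSz hRy hRz ha0 ha hcy hcz hΨyy hΨyz hΨzy hΨzz hΩz hσ hφ hs hθ hxy hcap
  · exact adjacent_pair_step_lattice (by norm_num) facts_11 hn hk hx hSy hSz hRy hRz ha0 ha hcy hcz hΨyy hΨyz hΨzy hΨzz hΩz hσ hφ hs hθ hxy hcap
  · exact adjacent_pair_step_lattice (by norm_num) facts_12 hn hk hx hSy hSz hRy hRz ha0 ha hcy hcz hΨyy hΨyz hΨzy hΨzz hΩz hσ hφ hs hθ hxy hcap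
  · exact adjacent_pair_step_lattice (by norm_num) facts_13 hn hk hx hSy hSz hRy hRz ha0 ha hcy hcz hΨyy hΨyz hΨzy hΨzz hΩz hσ hφ hs hθ hxy hcap
  · exact adjacent_pair_step_lattice (by norm_num) facts_14 hn hk hx hSy hSz hRy hRz ha0 ha hcy hcz hΨyy hΨyz hΨzy hΨzz hΩz hσ hφ hs hθ hxy hcap
  · exact adjacent_pair_step_lattice (by norm_num) facts_15 hn hk hx hSy hSz hRy hRz ha0 ha hcy hcz hΨyy hΨyz hΨzy hΨzz hΩz hσ hφ hs hθ hxy hcap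

/-! ## §2 Every adjacent pair -/

/-- **THE OBSERVER STEP (◆) ABOVE EVERY ADJACENT PAIR `(z+1, z)`, `z ≥ 1`, FOR EVERY LEVEL-COUPLED CONFIGURATION AND EVERY ADMISSIBLE LOAD** (`κ = 31∕40`; the
hypothesis `hdia` of (E78a) `observer_step`): §1 for `z ≤ 15`, (E78i) `adjacent_step_lattice` for `z ≥ 16`.  The binding family of the observer induction is
closed. [folklore] -/
theorem adjacent_step_lattice_all {n z : ℕ} {k : ℕ → ℕ} {x a cy cz Sy Sz Ry Rz : ℕ → ℝ} {θ xy Ψyy Ψyz Ψzy Ψzz Ωz σ φ s : ℝ}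
    (hn : 0 < n) (hz : 1 ≤ z) (hk : ∀ l, l < n → z + 2 ≤ k l) (hx : ∀ l, l < n → 0 ≤ x l)
    (hSy : ∀ l, l < n → Sy l = ∑ m ∈ range (z + 1), Real.sqrt ((k l : ℝ) / ((k l : ℝ) + m + 1)))
    (hSz : ∀ l, l < n → Sz l = ∑ m ∈ range z, Real.sqrt ((k l : ℝ) / ((k l : ℝ) + m + 1)))
    (hRy : ∀ l, l < n → Ry l = ∑ m ∈ range (k l), Real.sqrt (((z:ℝ) + 1) / (((z:ℝ) + 1) + m + 1)))
    (hRz : ∀ l, l < n → Rz l = ∑ m ∈ range (k l), Real.sqrt ((z : ℝ) / ((z : ℝ) + m + 1)))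
    (ha0 : ∀ i, i < n → 0 < a i)
    (ha : ∀ i, i < n → a i = 1 + ∑ l ∈ range n,
      (2 * x l * (∑ m ∈ range (k i), Real.sqrt ((k l : ℝ) / ((k l : ℝ) + m + 1))) / k l) * a l)
    (hcy : ∀ i, i < n → cy i = Ry i / ((z:ℝ) + 1) + ∑ l ∈ range n,
      (2 * x l * (∑ m ∈ range (k i), Real.sqrt ((k l : ℝ) / ((k l : ℝ) + m + 1))) / k l) * cy l)
    (hcz : ∀ i, i < n → cz i = Rz i / (z:ℝ) + ∑ l ∈ range n,
      (2 * x l * (∑ m ∈ range (k i), Real.sqrt ((k l : ℝ) / ((k l : ℝ) + m + 1))) / k l) * cz l)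
    (hΨyy : Ψyy = ∑ l ∈ range n, (2 * x l * Sy l / k l) * cy l) (hΨyz : Ψyz = ∑ l ∈ range n, (2 * x l * Sz l / k l) * cy l)
    (hΨzy : Ψzy = ∑ l ∈ range n, (2 * x l * Sy l / k l) * cz l) (hΨzz : Ψzz = ∑ l ∈ range n, (2 * x l * Sz l / k l) * cz l)
    (hΩz : Ωz = ∑ l ∈ range n, x l * (z:ℝ) / k l)
    (hσ : σ = (∑ m ∈ range z, Real.sqrt (((z:ℝ) + 1) / (((z:ℝ) + 1) + m + 1))) / ((z:ℝ) + 1))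
    (hφ : φ = (∑ m ∈ range (z + 1), Real.sqrt ((z : ℝ) / ((z : ℝ) + m + 1))) / (z:ℝ))
    (hs : s = (∑ m ∈ range (z + 1), Real.sqrt (((z:ℝ) + 1) / (((z:ℝ) + 1) + m + 1))) / ((z:ℝ) + 1))
    (hθ : θ ≤ 491/625) (hxy : 0 ≤ xy) (hcap : 2 * xy * (s + Ψyy) < 1) :
    (1 + 2 * (31/40:ℝ) * Ψzz) * (1 - Ωz) - (1 - θ) * (xy * (1 + 2 * (31/40:ℝ) * Ψyy))
      ≤ (1 - xy * (1 + 2 * (31/40:ℝ) * Ψyy)) *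
        ((1 + 2 * (31/40:ℝ) * Ψzz + 4 * (31/40:ℝ) * xy * ((σ + Ψyz) * (φ + Ψzy)) / (1 - 2 * (s + Ψyy) * xy)) * ((1 - Ωz) - xy / (((z:ℝ) + 1) / (z:ℝ)))) := by
  rcases le_or_gt 16 z with h16 | h15
  · exact adjacent_step_lattice hn h16 hk hx hSy hSz hRy hRz ha0 ha hcy hcz hΨyy hΨyz hΨzy hΨzz hΩz hσ hφ hs hθ hxy hcap
  · exact adjacent_step_lattice_le15 hn hz (by omega) hk hx hSy hSz hRy hRz ha0 ha hcy hcz hΨyy hΨyz hΨzy hΨzz hΩz hσ hφ hs hθ hxy hcap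

end Summit.QuantumFields.BalabanUV.Beta.EriceRemainderEnclosureHistoryAutonomyComparisonAgeCompositionStaticChainAdjacentAll

end
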